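import Literature.AnabelianGeometry.AbsoluteAnabelian.MonoidKummerMaps
import Literature.AnabelianGeometry.AbsoluteAnabelian.MLFGaloisModelPairs
import Literature.NumberTheory.GaloisRepresentations.LocalFieldPadicProofs
import Mathlib.FieldTheory.Galois.Profinite
import HarnessLib

/-!
# [AbsTopIII] Def 3.1: a concrete model (`k = ℚ_p`, `Π_k = G_k × ℤ`) of MLF-Galois `TM`-pairs, and
# the tightness of the hypothesis of Prop 3.2 (iv)'s center-freeness

Companion of `MLFGaloisPairs.lean` / `MonoidKummerMaps.lean` (seat abc-iut-L4-t2; S. Mochizuki, *Topics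
in Absolute Anabelian Geometry III*, Def 3.1 (i)(ii) pp.66–67, Prop 3.2 (iv) p.72, kurims manuscript,
lit key `paper:url-5493eb38cbb7`).

1. NON-VACUITY WITNESSES for the §3 interfaces.  `MLFClosure.ofPadic p` = the model data `k = ℚ_p`,
   `k̄ = AlgebraicClosure ℚ_p` (Mathlib's `IsNonarchimedeanLocalField ℚ_[p]` is the tree's PROVED
   `Padic.isNonarchimedeanLocalField_holds`); `ModelMLFGaloisData.galProd C Z` = the model datum
   "`Π_k` a topological group equipped with a continuous surjection `ε_k : Π_k ↠ G_k`" (Def 3.1 (i)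
   p.66) with `Π_k := G_k × Z` for ANY topological group `Z` and `ε_k` the first projection;
   with abc-iut-L4-t2's `ModelMLFGaloisData.tmPair` / `isMLFGaloisMonoidPair_tmPair` (every model
   pair is an MLF-Galois pair) this gives `exists_isMLFGaloisMonoidPair_TM`: the predicate
   `IsMLFGaloisMonoidPair .TM` is inhabited by a CONCRETE pair.
2. TIGHTNESS of Prop 3.2 (iv), center-freeness ("`Aut((Π ↷ M_T))` … is center-free" for `Π` "of
   hyperbolic orbicurve type"): the typed schema `AutPairCenterFree (IsOfHypOrbicurveType)` quantifies
   over a hypothesis predicate on the pair; abc-iut-L6-t13's `autPairCenterFree_of_isSlimGroup`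
   (p408338) shows it holds as soon as the predicate implies slimness of `Π`.  HERE:
   `not_autPairCenterFree_top : ¬ AutPairCenterFree (fun _ => True)` — with NO hypothesis the schema
   is FALSE: for `Π_k = G_k × ℤ` the pair-automorphism `(id_{G_k} × (−1), id_M)` is central and
   non-trivial.  So the slimness-type content of "hyperbolic orbicurve type" is load-bearing, exactly
   as the printed proof says ("follows immediately from the slimness of Π", p.72).  The proof that it
   is central uses only: `G_k` acts faithfully on `𝒪_k̄^⊳` (so every pair-automorphism preserves
   `ker ε_k = {1} × ℤ`), and `G_k` is compact while `ℤ` is discrete torsion-free (so every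
   pair-automorphism maps `G_k × {0}` into itself).

HONEST FRAMING: item 2 is a statement about OUR typed schema (which hypothesis it needs), not about
the mathematics of [AbsTopIII]; nothing here bears on [IUTchIII] Cor. 3.12.
-/

noncomputable section

namespace Literature.AnabelianGeometry.AbsoluteAnabelian

open Literature.NumberTheory.GaloisRepresentations
open _root_.ValuativeRel

/-! ### 1. Concrete model data -/

/-- The model data of [AbsTopIII] Def 3.1 (i) p.66 for `k = ℚ_p`: "Let `k` be an MLF, `k̄` an algebraic
closure of `k`" — `ℚ_p` with Mathlib's valuative structure (a non-archimedean local field by the tree's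
PROVED `Padic.isNonarchimedeanLocalField_holds`) and `k̄ := AlgebraicClosure ℚ_p`.
[cite: MochizukiAbsTopIII2015, Definition 3.1 (i) p.66] -/
def MLFClosure.ofPadic (p : ℕ) [Fact p.Prime] : MLFClosure.{0} :=
  letI : IsNonarchimedeanLocalField ℚ_[p] := Padic.isNonarchimedeanLocalField_holds p
  { k := ℚ_[p], K := AlgebraicClosure ℚ_[p] }

/-- The model datum "`Π_k` a topological group, equipped with a continuous surjection
`ε_k : Π_k ↠ G_k`" (Def 3.1 (i) p.66) with `Π_k := G_k × Z` for an arbitrary topological group `Z`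
and `ε_k :=` the first projection.
[cite: MochizukiAbsTopIII2015, Definition 3.1 (i) p.66] -/
def ModelMLFGaloisData.galProd (C : MLFClosure.{0}) (Z : Type) [Group Z] [TopologicalSpace Z]
    [IsTopologicalGroup Z] : ModelMLFGaloisData C.k C.K where
  Pi := (C.K ≃ₐ[C.k] C.K) × Z
  aug := MonoidHom.fst _ _
  continuous_aug := continuous_fst
  aug_surjective := Prod.fst_surjective

/-- NON-VACUITY: MLF-Galois `TM`-pairs exist CONCRETELY — e.g. the model `TM`-pair over `ℚ_2` with
`Π_k = G_k × ℤ` (abc-iut-L4-t2's `ModelMLFGaloisData.tmPair` / `isMLFGaloisMonoidPair_tmPair` applied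
to the concrete data `MLFClosure.ofPadic 2`). [cite: MochizukiAbsTopIII2015, Definition 3.1 (ii) p.67] -/
theorem exists_isMLFGaloisMonoidPair_TM : ∃ P : GaloisMonoidPair.{0}, IsMLFGaloisMonoidPair .TM P := by
  haveI : Fact (Nat.Prime 2) := ⟨Nat.prime_two⟩
  exact ⟨_, isMLFGaloisMonoidPair_tmPair (MLFClosure.ofPadic 2)
    (ModelMLFGaloisData.galProd (MLFClosure.ofPadic 2) (Multiplicative ℤ))⟩

/-! ### 2. Faithfulness of `G_k` on `𝒪_k̄^⊳` -/

/-- `G_k` acts faithfully on `𝒪_k̄^⊳`: a `k`-automorphism of `k̄` fixing every non-zero integral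
element is the identity (every element of `k̄` is a non-zero-integer multiple away from `𝒪_k̄`).
[cite: MochizukiAbsTopIII2015, Definition 3.1 (i) p.66] -/
theorem MLFClosure.algEquiv_eq_one_of_forall_nonzeroIntegers (C : MLFClosure.{0}) (σ : C.K ≃ₐ[C.k] C.K)
    (h : ∀ x : C.K, x ∈ nonzeroIntegers C.k C.K → σ x = x) : σ = 1 := by
  apply AlgEquiv.ext
  intro x
  by_cases hx : x = 0
  · simp [hx]
  -- `x` is algebraic over `k`, hence over `𝒪_k`; clear denominators
  have halg : IsAlgebraic C.k x := Algebra.IsAlgebraic.isAlgebraic x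
  have halg' : IsAlgebraic 𝒪[C.k] x := (IsFractionRing.isAlgebraic_iff 𝒪[C.k] C.k C.K).mpr halg
  obtain ⟨y, hy0, hint⟩ := halg'.exists_integral_multiple
  have hyx : (y • x) ∈ nonzeroIntegers C.k C.K := by
    refine ⟨(mem_integralClosure_iff _ _).mpr hint, ?_⟩
    rw [Algebra.smul_def]
    refine mul_ne_zero ?_ hx
    have : algebraMap 𝒪[C.k] C.K y = algebraMap C.k C.K (y : C.k) := rfl
    rw [this]
    exact (map_ne_zero _).mpr (by exact_mod_cast hy0)
  have h1 := h _ hyx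
  rw [Algebra.smul_def] at h1
  have halgmap : algebraMap 𝒪[C.k] C.K y = algebraMap C.k C.K (y : C.k) := rfl
  rw [halgmap, map_mul, AlgEquiv.commutes] at h1
  have hy0' : algebraMap C.k C.K (y : C.k) ≠ 0 := (map_ne_zero _).mpr (by exact_mod_cast hy0)
  simpa using mul_left_cancel₀ hy0' h1

/-! ### 3. Tightness of Prop 3.2 (iv), center-freeness: the hypothesis predicate is load-bearing -/

namespace AutPairCenterFreeWitness

/-- The model data `k = ℚ_2`, `k̄ = AlgebraicClosure ℚ_2` of the witness.
[cite: MochizukiAbsTopIII2015, Definition 3.1 (i) p.66] -/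
def C : MLFClosure.{0} := MLFClosure.ofPadic 2

/-- `G_k = Gal(k̄/k)` of the witness. [cite: MochizukiAbsTopIII2015, Definition 3.1 (i) p.66] -/
abbrev Gal : Type := C.K ≃ₐ[C.k] C.K

/-- The model datum `Π_k := G_k × ℤ ↠ G_k` of the witness (Def 3.1 (i): "a topological group,
equipped with a continuous surjection `ε_k : Π_k ↠ G_k`"). [cite: MochizukiAbsTopIII2015, Definition 3.1 (i) p.66] -/
def D : ModelMLFGaloisData C.k C.K := ModelMLFGaloisData.galProd C (Multiplicative ℤ)

/-- The witness pair `P = (G_k × ℤ ↷ 𝒪_k̄^⊳)` (the model `TM`-pair of `D`, abc-iut-L4-t2's `tmPair`).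
[cite: MochizukiAbsTopIII2015, Definition 3.1 (i) p.67] -/
def P : GaloisMonoidPair.{0} := D.tmPair

/-- `P` is an MLF-Galois `TM`-pair. [cite: MochizukiAbsTopIII2015, Definition 3.1 (ii) p.67] -/
theorem isMLFGaloisMonoidPair_P : IsMLFGaloisMonoidPair .TM P :=
  isMLFGaloisMonoidPair_tmPair C D

/-- The identification `G_k × ℤ = Π_P` (definitionally the identity). [folklore] -/
def toPi (g : Gal × Multiplicative ℤ) : P.Pi := g

/-- The action of `(σ, n) ∈ Π_P = G_k × ℤ` on `x ∈ 𝒪_k̄^⊳` is `x ↦ σ x`.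
[cite: MochizukiAbsTopIII2015, Definition 3.1 (i) p.67] -/
theorem smul_val (g : Gal × Multiplicative ℤ) (x : P.M) : (toPi g • x).val = g.1 x.val := rfl

/-- The Galois component of a pair-automorphism of `P`, as an automorphism of the honest product
group `G_k × ℤ`. [cite: MochizukiAbsTopIII2015, Definition 3.1 (ii) p.67] -/
def isoProd (e' : GaloisMonoidPair.Iso P P) : (Gal × Multiplicative ℤ) ≃* (Gal × Multiplicative ℤ) where
  toFun g := e'.isoPi (toPi g)
  invFun g := e'.isoPi.symm (toPi g)
  left_inv g := e'.isoPi.symm_apply_apply (toPi g)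
  right_inv g := e'.isoPi.apply_symm_apply (toPi g)
  map_mul' a b := e'.isoPi.map_mul (toPi a) (toPi b)

/-- `isoProd e'` is `e'.isoPi` (definitionally). [folklore] -/
private theorem toPi_isoProd (e' : GaloisMonoidPair.Iso P P) (g : Gal × Multiplicative ℤ) :
    toPi (isoProd e' g) = e'.isoPi (toPi g) := rfl

/-- `isoProd e'` is continuous (it is the homeomorphism `e'.isoPi`). [folklore] -/
private theorem continuous_isoProd (e' : GaloisMonoidPair.Iso P P) : Continuous (isoProd e') :=
  e'.isoPi.continuous

/-- The automorphism `(σ, n) ↦ (σ, −n)` of `G_k × ℤ`. [folklore] -/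
def flipProd : (Gal × Multiplicative ℤ) ≃ₜ* (Gal × Multiplicative ℤ) :=
  ContinuousMulEquiv.mk'
    (Homeomorph.prodCongr (Homeomorph.refl Gal) (Homeomorph.inv (Multiplicative ℤ)))
    (by
      intro a b
      refine Prod.ext rfl ?_
      show ((a * b).2)⁻¹ = (a.2)⁻¹ * (b.2)⁻¹
      exact mul_inv a.2 b.2)

/-- `flipProd (σ, n) = (σ, n⁻¹)`. [folklore] -/
private theorem flipProd_apply (g : Gal × Multiplicative ℤ) : flipProd g = (g.1, (g.2)⁻¹) := rfl

/-- The candidate central pair-automorphism `e = (flip, id)` of `P`.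
[cite: MochizukiAbsTopIII2015, Proposition 3.2 (iv) p.72] -/
def e : GaloisMonoidPair.Iso P P where
  isoPi := show P.Pi ≃ₜ* P.Pi from flipProd
  isoM := MulEquiv.refl _
  smul_comm g x := by
    apply Subtype.ext
    obtain ⟨σ, n⟩ := g
    change (toPi (σ, n) • x).val = (toPi (flipProd (σ, n)) • x).val
    rw [smul_val, smul_val, flipProd_apply]

/-- `e` moves `(1, 1) ∈ G_k × ℤ`. [folklore] -/
private theorem e_isoPi_ne :
    e.isoPi (toPi ((1 : Gal), Multiplicative.ofAdd (1 : ℤ))) ≠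
      toPi ((1 : Gal), Multiplicative.ofAdd (1 : ℤ)) := by
  intro h1
  have h2 : flipProd ((1 : Gal), Multiplicative.ofAdd (1 : ℤ)) =
      ((1 : Gal), Multiplicative.ofAdd (1 : ℤ)) := h1
  have h3 := congrArg (fun g : Gal × Multiplicative ℤ => Multiplicative.toAdd g.2) h2
  simp only [flipProd_apply, toAdd_inv, toAdd_ofAdd] at h3
  norm_num at h3

/-- Every pair-automorphism `(F, β)` of `P` maps the kernel `{1} × ℤ` of the action into itself
(`G_k` acts faithfully on `𝒪_k̄^⊳`). [cite: MochizukiAbsTopIII2015, Definition 3.1 (ii) p.67] -/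
theorem isoProd_fst_one (e' : GaloisMonoidPair.Iso P P) (n : Multiplicative ℤ) :
    (isoProd e' (1, n)).1 = 1 := by
  apply MLFClosure.algEquiv_eq_one_of_forall_nonzeroIntegers C
  intro y hy
  obtain ⟨x, hx⟩ := e'.isoM.surjective ⟨y, hy⟩
  have h1 := e'.smul_comm (toPi ((1 : Gal), n)) x
  have hgx : toPi ((1 : Gal), n) • x = x := by
    apply Subtype.ext
    rw [smul_val]
    rfl
  rw [hgx, hx, ← toPi_isoProd] at h1
  have h2 := congrArg Subtype.val h1
  rw [smul_val] at h2
  exact h2.symm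

/-- Every pair-automorphism `(F, β)` of `P` maps `G_k × {0}` into `G_k × {0}`: the character
`σ ↦ pr₂ (F (σ, 0))` of the compact group `G_k` into the discrete torsion-free group `ℤ` is trivial.
[folklore] -/
private theorem isoProd_snd_one (e' : GaloisMonoidPair.Iso P P) (σ : Gal) : (isoProd e' (σ, 1)).2 = 1 := by
  let χ : Gal →* Multiplicative ℤ :=
    (MonoidHom.snd Gal (Multiplicative ℤ)).comp
      ((isoProd e').toMonoidHom.comp (MonoidHom.inl Gal (Multiplicative ℤ)))
  have hχ : ∀ τ, χ τ = (isoProd e' (τ, 1)).2 := fun τ => rfl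
  have hχc : Continuous χ :=
    continuous_snd.comp ((continuous_isoProd e').comp (continuous_id.prodMk continuous_const))
  have hfin : (Set.range χ).Finite := (isCompact_range hχc).finite_of_discrete
  have hmem : ∀ i : ℕ, (fun i : ℕ => χ σ ^ i) i ∈ Set.range χ := fun i => ⟨σ ^ i, by simp⟩
  obtain ⟨i, j, hij, hEq⟩ := hfin.exists_lt_map_eq_of_forall_mem hmem
  have hpow : χ σ ^ (j - i) = 1 := by
    have h := pow_mul_pow_sub (χ σ) hij.le
    rw [← hEq] at h
    exact mul_left_cancel (h.trans (mul_one _).symm)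
  have h3 : ((j - i : ℕ) : ℤ) * Multiplicative.toAdd (χ σ) = 0 := by
    have := congrArg Multiplicative.toAdd hpow
    simpa [toAdd_pow] using this
  rw [← hχ]
  rcases mul_eq_zero.mp h3 with h4 | h4
  · omega
  · exact Multiplicative.toAdd.injective (h4.trans toAdd_one.symm)

/-- Hence every pair-automorphism of `P` acts on `Π_P = G_k × ℤ` diagonally:
`F (σ, n) = (pr₁ F(σ, 0), pr₂ F(1, n))`. [folklore] -/
private theorem isoProd_apply (e' : GaloisMonoidPair.Iso P P) (σ : Gal) (n : Multiplicative ℤ) :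
    isoProd e' (σ, n) = ((isoProd e' (σ, 1)).1, (isoProd e' (1, n)).2) := by
  have hmul : ((σ, n) : Gal × Multiplicative ℤ) = (σ, 1) * (1, n) := by simp
  rw [hmul, map_mul]
  refine Prod.ext ?_ ?_
  · rw [Prod.fst_mul, isoProd_fst_one, mul_one]
  · rw [Prod.snd_mul, isoProd_snd_one, one_mul]

/-- `isoProd e'` commutes with `flipProd`. [folklore] -/
private theorem flipProd_isoProd (e' : GaloisMonoidPair.Iso P P) (g : Gal × Multiplicative ℤ) :
    flipProd (isoProd e' g) = isoProd e' (flipProd g) := by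
  obtain ⟨σ, n⟩ := g
  rw [flipProd_apply, flipProd_apply, isoProd_apply e' σ n]
  show (((isoProd e' (σ, 1)).1, ((isoProd e' (1, n)).2)⁻¹) : Gal × Multiplicative ℤ) =
    isoProd e' (σ, n⁻¹)
  rw [isoProd_apply e' σ n⁻¹]
  refine Prod.ext rfl ?_
  show ((isoProd e' (1, n)).2)⁻¹ = (isoProd e' (1, n⁻¹)).2
  have hinv : (((1 : Gal), n⁻¹) : Gal × Multiplicative ℤ) = ((1, n) : Gal × Multiplicative ℤ)⁻¹ := by
    simp
  rw [hinv, map_inv, Prod.snd_inv]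

/-- `e` is central among the pair-automorphisms of `P` (Galois components; the object components
commute trivially since `e.isoM = id`). [folklore] -/
private theorem e_central_isoPi (e' : GaloisMonoidPair.Iso P P) (g : P.Pi) :
    e.isoPi (e'.isoPi g) = e'.isoPi (e.isoPi g) := by
  obtain ⟨σ, n⟩ := g
  exact flipProd_isoProd e' (σ, n)

end AutPairCenterFreeWitness

open AutPairCenterFreeWitness in
/-- **Tightness of the typed schema `AutPairCenterFree`** ([AbsTopIII] Prop 3.2 (iv) p.72: "if [...]
`Π` is of hyperbolic orbicurve type, then `Aut((Π ↷ M_T))` is center-free"; typed over a hypothesis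
predicate `IsOfHypOrbicurveType` on pairs, TODO-merge abc-iut-L4-t1): with the TRIVIAL predicate the
schema is FALSE.  Witness: the model `TM`-pair over `k = ℚ_2` with `Π_k := G_k × ℤ` (`ε_k` = first
projection; Def 3.1 (i) allows any topological group with a continuous surjection onto `G_k`); the
pair-automorphism `e := (id_{G_k} × (n ↦ −n), id_{𝒪_k̄^⊳})` is non-trivial and central in the
automorphism group of the pair — every pair-automorphism `(F, β)` satisfies `F({1} × ℤ) ⊆ {1} × ℤ`
(`{1} × ℤ` is the kernel of the action, `G_k` acting faithfully on `𝒪_k̄^⊳`) and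
`F(G_k × {0}) ⊆ G_k × {0}` (`G_k` is compact, `ℤ` discrete and torsion-free), hence commutes with `e`.
Complements `autPairCenterFree_of_isSlimGroup` (abc-iut-L6-t13): the schema holds as soon as the
predicate implies slimness of `Π`, exactly as the printed proof says ("follows immediately from the
slimness of `Π`").  A statement about OUR typing (which hypothesis the schema needs), not about
[AbsTopIII]. [cite: MochizukiAbsTopIII2015, Proposition 3.2 (iv) p.72] -/
theorem not_autPairCenterFree_top : ¬ AutPairCenterFree (fun _ => True) := by
  intro h
  have hc := h P isMLFGaloisMonoidPair_P trivial e (fun _ _ => rfl) e_central_isoPi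
  exact e_isoPi_ne (hc.2 _)

end Literature.AnabelianGeometry.AbsoluteAnabelian

end
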